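import Summits.Ventures.LatticeQCDFlow.Scaling.CollectorFloor
import Summits.Ventures.LatticeQCDFlow.Scaling.HubProposalLaw
import Summits.Ventures.LatticeQCDFlow.Scaling.FlowSamplerTunnelingTime

/-!
HONEST FRAMING: exact (Metropolis-corrected) sampling algorithms for lattice gauge theory; figures
of merit are autocorrelation/cost numbers at stated couplings and volumes; no continuum-physics
claim.

# ExchangeSchemeCollector — THE COUPON-COLLECTOR FLOOR FOR EXCHANGE SCHEMES ON ANY SWAP LIST: THE SCHEME
# `t·GSw + (1−t)·PK` IS A MIXTURE OF LOCAL MOVES (ENTRY `r` WITH WEIGHT `t/m` TOUCHING ITS TWO ENDPOINTS, LEVEL UPDATE `k`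
# WITH WEIGHT `(1−t)w_k` TOUCHING `{k}`), SO FROM ANY START `x`, ON ANY SET `T` OF LEVELS NO ENTRY JOINS,
# `(δ_x Pⁿ){z : z_k ≠ x_k ∀ k ∈ T} ≤ 1/Σ_{k∈T}(1−θ_k)ⁿ` WITH `θ_k = t·deg(k)/m + (1−t)w_k`, AND
# `d(n) ≥ 1 − 1/Σ_{k∈T}(1−θ_k)ⁿ − Σ_{k∈T} μ_k(x_k)` (lean-2 GEN-24, ours)

Venture-side (OURS).  Cell `lqcd-flow` (pub-lqcd), unit `pub-lqcd-lean-2-g24`, 2026-08-27.  Chapter L (the coupon-collector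
law from a cold start), file 4: the abstract floor of `Scaling/CollectorFloor` instantiated on the weighted exchange
scheme `P = t·ptGraphSwap μ e φ + (1−t)·prodKernel w M` of chapters G–K (edge list `e : Fin m → Fin (K+1) × Fin (K+1)`
with distinct endpoints, maps `φ_r`, update weights `w`, `μ_k`-reversible update kernels `M_k`; `deg(k)` = the number of
entries with an endpoint at level `k`, as in `Scaling/HubProposalLaw`).

## What is proved

* §1 **`ptGraphSwap_eq_avg_entryKernel`** — THE METROPOLIS GRAPH SWAP IS THE AVERAGE OF THE ENTRY SWAPS:
  `GSw = (1/m)·Σ_r Met_r`, `Met_r` the Metropolis kernel of the deterministic proposal `x ↦ x^{(r)}` (two transition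
  matrices that agree off the diagonal agree: `eq_of_offDiag_eq`); `entryKernel_local` / `coordKernel_local` — an entry
  swap moves only its endpoints, a level update only its level.
* §2 **`exchangeScheme_eq_mixture`** — `P(y,z) = Σ_a c_a·Pm a(y,z)` over `a ∈ Fin m ⊕ Fin (K+1)`; **`exchangeScheme_touchRate`**
  — the touch rate of level `k` is `θ_k = t·deg(k)/m + (1−t)·w_k`; `exchangeScheme_independent` — a set of levels no
  entry joins is independent for the schedule.
* §3 **`exchangeScheme_lawAt_allMoved_le`** — `(δ_x Pⁿ){z : ∀ k ∈ T, z_k ≠ x_k} ≤ 1/Σ_{k∈T}(1−θ_k)ⁿ`;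
  `tensorFun_mass_someKept_le` (`π̃{z : ∃ k ∈ T, z_k = x_k} ≤ Σ_{k∈T} μ_k(x_k)`); **`exchangeScheme_worstTvDist_ge`** —
  `d(n) ≥ 1 − 1/Σ_{k∈T}(1−θ_k)ⁿ − Σ_{k∈T} μ_k(x_k)`; `exchangeScheme_lt_mixingTime` (`n < t_mix(ε)` once that bound exceeds
  `ε`); **`exchangeScheme_mixingTime_ge` (THE COUPON-COLLECTOR FLOOR FOR
  EXCHANGE SCHEMES)** — `θ_k ≤ θ` on a non-empty `T` no entry joins (`0 < θ < 1`), a configuration `x` with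
  `Σ_{k∈T} μ_k(x_k) ≤ δ`, `0 < η`, `ε < 1 − η − δ`, the scheme `ε`-close to `π̃` at some time:
  **`t_mix(ε) ≥ ((1−θ)/θ)·log(|T|·η)`**.

Reading (no numerics implied): a replica whose level has not yet been drawn — neither as a swap endpoint nor for an
update — still holds its initial configuration, whatever the maps, laws and acceptances are; so no exchange scheme is
close to equilibrium from a start that is atypical at the levels of `T` before the proposal schedule has collected every
level of `T`, which costs the coupon-collector time in the per-step touch probability `θ`.  NOT CLAIMED: sets `T`
containing both endpoints of an entry (cold–cold or hub pairs inside `T`); anything measured.  Literature grade (cell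
rule): OWN COMPOSITION (chapter-L files 1–3 + the scheme's bookkeeping); nothing cited as a fact; no new bib keys.
-/

noncomputable section

open Finset Function
open Literature.Probability.MarkovChains

namespace Summit.Ventures.LatticeQCDFlow.Scaling

variable {S : Type*} [Fintype S] [DecidableEq S] {K m : ℕ} {μ : Fin (K + 1) → S → ℝ}
  {M : Fin (K + 1) → S → S → ℝ} {w : Fin (K + 1) → ℝ} {t : ℝ} {e : Fin m → Fin (K + 1) × Fin (K + 1)}
  {φ : Fin m → Equiv.Perm S}

/-! ## §1 The graph swap is the average of the entry swaps; locality -/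

omit [DecidableEq S] in
/-- Two transition matrices that agree off the diagonal agree. [ours] -/
theorem eq_of_offDiag_eq {X : Type*} [Fintype X] [DecidableEq X] {A B : X → X → ℝ} (hA : IsRowStochastic A)
    (hB : IsRowStochastic B) (h : ∀ x y, y ≠ x → A x y = B x y) (x y : X) : A x y = B x y := by
  by_cases hyx : y ≠ x
  · exact h x y hyx
  · push Not at hyx
    subst hyx
    have hA1 := hA.2 y
    have hB1 := hB.2 y
    rw [← Finset.add_sum_erase _ _ (mem_univ y)] at hA1 hB1
    have hoff : ∑ z ∈ univ.erase y, A y z = ∑ z ∈ univ.erase y, B y z :=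
      sum_congr rfl fun z hz => h y z (Finset.ne_of_mem_erase hz)
    linarith

/-- The deterministic entry proposal `𝟙{z = y^{(r)}}` is non-negative with row sums `≤ 1`, and symmetric. [ours] -/
theorem entryProposal_basic (he : ∀ r, (e r).1 ≠ (e r).2) (r : Fin m) :
    (∀ y z : Fin (K + 1) → S, 0 ≤ (if z = edgeFlowSwap (φ r) (e r).1 (e r).2 y then (1 : ℝ) else 0)) ∧
    (∀ y : Fin (K + 1) → S, ∑ z, (if z = edgeFlowSwap (φ r) (e r).1 (e r).2 y then (1 : ℝ) else 0) ≤ 1) ∧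
    (∀ y z : Fin (K + 1) → S, (if z = edgeFlowSwap (φ r) (e r).1 (e r).2 y then (1 : ℝ) else 0)
      = (if y = edgeFlowSwap (φ r) (e r).1 (e r).2 z then (1 : ℝ) else 0)) := by
  refine ⟨fun y z => by split_ifs <;> norm_num, fun y => ?_, fun y z => ?_⟩
  · rw [Finset.sum_ite_eq' univ, if_pos (mem_univ _)]
  · exact if_congr (eq_edgeFlowSwap_comm (φ r) (he r) y z) rfl rfl

/-- **THE METROPOLIS GRAPH SWAP IS THE AVERAGE OF THE ENTRY SWAPS: `GSw = (1/m)·Σ_r Met_r`** (`m ≥ 1`, distinct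
endpoints, positive laws). [ours] -/
theorem ptGraphSwap_eq_avg_entryKernel (hm : 1 ≤ m) (he : ∀ r, (e r).1 ≠ (e r).2) (hμ : ∀ k x, 0 < μ k x)
    (y z : Fin (K + 1) → S) :
    ptGraphSwap μ e φ y z = ∑ r : Fin m, (1 : ℝ) / m *
      mhKernel (fun a b => if b = edgeFlowSwap (φ r) (e r).1 (e r).2 a then (1 : ℝ) else 0) (tensorFun μ) y z := by
  have hmpos : (0 : ℝ) < m := Nat.cast_pos.mpr (by omega)
  have hπ := tensorFun_pos hμ
  have hE : ∀ r : Fin m, IsRowStochastic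
      (mhKernel (fun a b : Fin (K + 1) → S => if b = edgeFlowSwap (φ r) (e r).1 (e r).2 a then (1 : ℝ) else 0)
        (tensorFun μ)) :=
    fun r => mhKernel_isRowStochastic (entryProposal_basic (φ := φ) he r).1 (entryProposal_basic (φ := φ) he r).2.1 hπ
  have hB : IsRowStochastic (fun y z : Fin (K + 1) → S => ∑ r : Fin m, (1 : ℝ) / m *
      mhKernel (fun a b => if b = edgeFlowSwap (φ r) (e r).1 (e r).2 a then (1 : ℝ) else 0) (tensorFun μ) y z) :=
    mixture_isRowStochastic (c := fun _ : Fin m => (1 : ℝ) / m) (fun _ => by positivity)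
      (by rw [sum_const, card_univ, Fintype.card_fin, nsmul_eq_mul, mul_one_div_cancel hmpos.ne']) hE (fun _ _ => rfl)
  refine eq_of_offDiag_eq (ptGraphSwap_isRowStochastic hμ) hB (fun y z hzy => ?_) y z
  -- off the diagonal: multiply by `π̃(y) > 0`
  have hl := tensorFun_mul_ptGraphSwap (e := e) (φ := φ) hμ he hzy
  have hr : tensorFun μ y * (∑ r : Fin m, (1 : ℝ) / m *
      mhKernel (fun a b => if b = edgeFlowSwap (φ r) (e r).1 (e r).2 a then (1 : ℝ) else 0) (tensorFun μ) y z)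
      = ptGraphProposal e φ y z * min (tensorFun μ y) (tensorFun μ z) := by
    unfold ptGraphProposal
    rw [mul_sum, sum_mul]
    refine sum_congr rfl fun r _ => ?_
    rw [mul_left_comm, mhKernel_of_ne hzy, mul_mhRate hπ, (entryProposal_basic (φ := φ) he r).2.2 z y,
      ← min_mul_of_nonneg _ _ ((entryProposal_basic (φ := φ) he r).1 y z)]
    split_ifs <;> ring
  exact mul_left_cancel₀ (hπ y).ne' (hl.trans hr.symm)

/-- **An entry swap moves only its endpoints:** `Met_r(y,z) ≠ 0`, `k ∉ {i_r, l_r}` ⇒ `z_k = y_k`. [ours] -/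
theorem entryKernel_local (he : ∀ r, (e r).1 ≠ (e r).2) (r : Fin m) (y z : Fin (K + 1) → S) (k : Fin (K + 1))
    (hk : k ∉ ({(e r).1, (e r).2} : Finset (Fin (K + 1))))
    (h : mhKernel (fun a b => if b = edgeFlowSwap (φ r) (e r).1 (e r).2 a then (1 : ℝ) else 0) (tensorFun μ) y z ≠ 0) :
    z k = y k := by
  by_cases hzy : z = y
  · rw [hzy]
  · rw [mhKernel_of_ne hzy] at h
    have hz : z = edgeFlowSwap (φ r) (e r).1 (e r).2 y := by
      by_contra hne
      apply h
      unfold mhRate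
      dsimp only
      have h1 : (if z = edgeFlowSwap (φ r) (e r).1 (e r).2 y then (1 : ℝ) else 0) = 0 := if_neg hne
      have h2 : (if y = edgeFlowSwap (φ r) (e r).1 (e r).2 z then (1 : ℝ) else 0) = 0 :=
        if_neg fun h' => hne ((eq_edgeFlowSwap_comm (φ r) (he r) z y).mp h')
      rw [h1, h2, mul_zero, zero_div, min_self]
    rw [Finset.mem_insert, Finset.mem_singleton, not_or] at hk
    rw [hz, edgeFlowSwap_of_ne _ _ _ _ hk.1 hk.2]

omit [Fintype S] in
/-- **A level update moves only its level:** `coordKernel M k (y,z) ≠ 0`, `j ≠ k` ⇒ `z_j = y_j`. [ours] -/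
theorem coordKernel_local (k : Fin (K + 1)) (y z : Fin (K + 1) → S) (j : Fin (K + 1))
    (hj : j ∉ ({k} : Finset (Fin (K + 1)))) (h : coordKernel M k y z ≠ 0) : z j = y j := by
  rw [Finset.mem_singleton] at hj
  unfold coordKernel at h
  by_cases hz : z = update y k (z k)
  · have := congrFun hz j
    rw [update_of_ne hj] at this
    exact this
  · exact absurd (if_neg hz) h

/-! ## §2 The scheme as a mixture of local moves; touch rates; independence -/

/-- **THE EXCHANGE SCHEME IS A MIXTURE OF LOCAL MOVES** indexed by `Fin m ⊕ Fin (K+1)`: entry `r` with weight `t/m` and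
kernel `Met_r`, level `k` with weight `(1−t)·w_k` and kernel `coordKernel M k`. [ours] -/
theorem exchangeScheme_eq_mixture (hm : 1 ≤ m) (he : ∀ r, (e r).1 ≠ (e r).2) (hμ : ∀ k x, 0 < μ k x)
    (y z : Fin (K + 1) → S) :
    t * ptGraphSwap μ e φ y z + (1 - t) * prodKernel w M y z
      = ∑ a : Fin m ⊕ Fin (K + 1), Sum.elim (fun _ : Fin m => t / m) (fun k => (1 - t) * w k) a *
          Sum.elim (fun r => mhKernel (fun a b : Fin (K + 1) → S =>
              if b = edgeFlowSwap (φ r) (e r).1 (e r).2 a then (1 : ℝ) else 0) (tensorFun μ))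
            (fun k => coordKernel M k) a y z := by
  rw [Fintype.sum_sum_type]
  simp only [Sum.elim_inl, Sum.elim_inr]
  rw [ptGraphSwap_eq_avg_entryKernel hm he hμ y z, prodKernel_apply, mul_sum, mul_sum]
  congr 1
  · refine sum_congr rfl fun r _ => ?_
    rw [← mul_assoc, mul_one_div]
  · exact sum_congr rfl fun k _ => by ring

omit [Fintype S] [DecidableEq S] in
/-- **THE TOUCH RATE OF LEVEL `k` IS `θ_k = t·deg(k)/m + (1−t)·w_k`.** [ours] -/
theorem exchangeScheme_touchRate (k : Fin (K + 1)) :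
    ∑ a ∈ univ.filter (fun a : Fin m ⊕ Fin (K + 1) =>
        k ∈ Sum.elim (fun r => ({(e r).1, (e r).2} : Finset (Fin (K + 1)))) (fun j => {j}) a),
      Sum.elim (fun _ : Fin m => t / m) (fun j => (1 - t) * w j) a
      = t * ((univ.filter fun r : Fin m => (e r).1 = k ∨ (e r).2 = k).card : ℝ) / m + (1 - t) * w k := by
  rw [Finset.sum_filter, Fintype.sum_sum_type]
  simp only [Sum.elim_inl, Sum.elim_inr, Finset.mem_insert, Finset.mem_singleton]
  congr 1
  · rw [← Finset.sum_filter, sum_const, nsmul_eq_mul]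
    have hf : univ.filter (fun r : Fin m => k = (e r).1 ∨ k = (e r).2)
        = univ.filter (fun r : Fin m => (e r).1 = k ∨ (e r).2 = k) :=
      Finset.filter_congr fun r _ => by rw [eq_comm, @eq_comm _ k]
    rw [hf]; ring
  · rw [Finset.sum_ite_eq univ k, if_pos (mem_univ _)]

omit [Fintype S] [DecidableEq S] in
/-- **A set of levels no entry joins is independent for the schedule** (no move touches two of its levels). [ours] -/
theorem exchangeScheme_independent {T : Finset (Fin (K + 1))} (hT : ∀ r, ¬((e r).1 ∈ T ∧ (e r).2 ∈ T)) :
    ∀ a : Fin m ⊕ Fin (K + 1), ∀ k ∈ T, ∀ l ∈ T, k ≠ l →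
      ¬(k ∈ Sum.elim (fun r => ({(e r).1, (e r).2} : Finset (Fin (K + 1)))) (fun j => {j}) a ∧
        l ∈ Sum.elim (fun r => ({(e r).1, (e r).2} : Finset (Fin (K + 1)))) (fun j => {j}) a) := by
  rintro (r | j) k hk l hl hkl ⟨h1, h2⟩
  · simp only [Sum.elim_inl, Finset.mem_insert, Finset.mem_singleton] at h1 h2
    rcases h1 with rfl | rfl <;> rcases h2 with h2 | h2
    · exact hkl h2.symm
    · exact hT r ⟨hk, h2 ▸ hl⟩
    · exact hT r ⟨h2 ▸ hl, hk⟩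
    · exact hkl h2.symm
  · simp only [Sum.elim_inr, Finset.mem_singleton] at h1 h2
    exact hkl (h1.trans h2.symm)

/-! ## §3 The coupon-collector floor for exchange schemes -/

section Floor

/-- The weights of the mixture are non-negative (`0 ≤ t ≤ 1`, `w ≥ 0`). [ours] -/
theorem exchangeScheme_weights_nonneg (hw0 : ∀ k, 0 ≤ w k) (ht0 : 0 ≤ t) (ht1 : t ≤ 1) :
    ∀ a : Fin m ⊕ Fin (K + 1), 0 ≤ Sum.elim (fun _ : Fin m => t / m) (fun k => (1 - t) * w k) a := by
  rintro (r | k)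
  · simp only [Sum.elim_inl]; positivity
  · simp only [Sum.elim_inr]; exact mul_nonneg (by linarith) (hw0 k)

/-- The weights of the mixture sum to one (`m ≥ 1`, `Σ w = 1`). [ours] -/
theorem exchangeScheme_weights_sum (hm : 1 ≤ m) (hw1 : ∑ k, w k = 1) :
    ∑ a : Fin m ⊕ Fin (K + 1), Sum.elim (fun _ : Fin m => t / m) (fun k => (1 - t) * w k) a = 1 := by
  have hmpos : (0 : ℝ) < m := Nat.cast_pos.mpr (by omega)
  rw [Fintype.sum_sum_type]
  simp only [Sum.elim_inl, Sum.elim_inr]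
  rw [sum_const, card_univ, Fintype.card_fin, nsmul_eq_mul, ← mul_sum, hw1, mul_one, mul_div_cancel₀ _ hmpos.ne']
  ring

/-- Every kernel of the mixture is a transition matrix. [ours] -/
theorem exchangeScheme_kernels_isRowStochastic (he : ∀ r, (e r).1 ≠ (e r).2) (hμ : ∀ k x, 0 < μ k x)
    (hM : ∀ k, IsRowStochastic (M k)) :
    ∀ a : Fin m ⊕ Fin (K + 1), IsRowStochastic (Sum.elim
      (fun r => mhKernel (fun a b : Fin (K + 1) → S => if b = edgeFlowSwap (φ r) (e r).1 (e r).2 a then (1 : ℝ) else 0)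
        (tensorFun μ))
      (fun k => coordKernel M k) a) := by
  rintro (r | k)
  · simp only [Sum.elim_inl]
    exact mhKernel_isRowStochastic (entryProposal_basic (φ := φ) he r).1 (entryProposal_basic (φ := φ) he r).2.1
      (tensorFun_pos hμ)
  · simp only [Sum.elim_inr]
    refine ⟨fun y z => coordKernel_nonneg M (fun j u v => (hM j).1 u v) k y z, fun y => ?_⟩
    have h := sum_coordKernel_mul M k y (fun _ => (1 : ℝ))
    simp only [mul_one] at h
    rw [h, (hM k).2]

/-- Every kernel of the mixture is local: it moves only the levels it touches. [ours] -/
theorem exchangeScheme_kernels_local (he : ∀ r, (e r).1 ≠ (e r).2) :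
    ∀ (a : Fin m ⊕ Fin (K + 1)) (y z : Fin (K + 1) → S) (k : Fin (K + 1)),
      k ∉ Sum.elim (fun r => ({(e r).1, (e r).2} : Finset (Fin (K + 1)))) (fun j => {j}) a →
      Sum.elim (fun r => mhKernel (fun a b : Fin (K + 1) → S =>
          if b = edgeFlowSwap (φ r) (e r).1 (e r).2 a then (1 : ℝ) else 0) (tensorFun μ))
        (fun k => coordKernel M k) a y z ≠ 0 → z k = y k := by
  rintro (r | j) y z k hk h
  · exact entryKernel_local (μ := μ) he r y z k hk h
  · exact coordKernel_local (M := M) j y z k hk h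

omit [Fintype S] [DecidableEq S] in
/-- The touch sum in closed form: `Σ_{k∈T}(1 − θ_k)ⁿ` with `θ_k = t·deg(k)/m + (1−t)·w_k`. [ours] -/
theorem exchangeScheme_touchSum_eq (T : Finset (Fin (K + 1))) (n : ℕ) :
    ∑ k ∈ T, (1 - ∑ a ∈ univ.filter (fun a : Fin m ⊕ Fin (K + 1) =>
        k ∈ Sum.elim (fun r => ({(e r).1, (e r).2} : Finset (Fin (K + 1)))) (fun j => {j}) a),
      Sum.elim (fun _ : Fin m => t / m) (fun j => (1 - t) * w j) a) ^ n
      = ∑ k ∈ T, (1 - (t * ((univ.filter fun r : Fin m => (e r).1 = k ∨ (e r).2 = k).card : ℝ) / m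
          + (1 - t) * w k)) ^ n :=
  sum_congr rfl fun k _ => by rw [exchangeScheme_touchRate (e := e) (w := w) (t := t) k]

/-- **`(δ_x Pⁿ){z : ∀ k ∈ T, z_k ≠ x_k} ≤ 1/Σ_{k∈T}(1 − θ_k)ⁿ`** for the exchange scheme on any list, any start `x`,
any set `T` of levels no entry joins, `θ_k = t·deg(k)/m + (1−t)·w_k`. [ours] -/
theorem exchangeScheme_lawAt_allMoved_le (hm : 1 ≤ m) (he : ∀ r, (e r).1 ≠ (e r).2) (hμ : ∀ k x, 0 < μ k x)
    (hM : ∀ k, IsRowStochastic (M k)) (hw0 : ∀ k, 0 ≤ w k) (hw1 : ∑ k, w k = 1) (ht0 : 0 ≤ t) (ht1 : t ≤ 1)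
    (x : Fin (K + 1) → S) (T : Finset (Fin (K + 1))) (hT : ∀ r, ¬((e r).1 ∈ T ∧ (e r).2 ∈ T)) (n : ℕ)
    (hs : 0 < ∑ k ∈ T, (1 - (t * ((univ.filter fun r : Fin m => (e r).1 = k ∨ (e r).2 = k).card : ℝ) / m
          + (1 - t) * w k)) ^ n) :
    ∑ z ∈ univ.filter (fun z : Fin (K + 1) → S => ∀ k ∈ T, z k ≠ x k),
        lawAt (fun y z : Fin (K + 1) → S => t * ptGraphSwap μ e φ y z + (1 - t) * prodKernel w M y z)
          (Pi.single x 1) n z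
      ≤ 1 / ∑ k ∈ T, (1 - (t * ((univ.filter fun r : Fin m => (e r).1 = k ∨ (e r).2 = k).card : ℝ) / m
          + (1 - t) * w k)) ^ n := by
  have hsum := exchangeScheme_touchSum_eq (e := e) (w := w) (t := t) T n
  have hs' := hs
  rw [← hsum] at hs'
  have h := lawAt_allMoved_le_inv (exchangeScheme_weights_nonneg (m := m) hw0 ht0 ht1)
    (exchangeScheme_weights_sum (t := t) hm hw1)
    (exchangeScheme_kernels_isRowStochastic (φ := φ) he hμ hM) (exchangeScheme_kernels_local (μ := μ) (M := M) (φ := φ) he)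
    (fun y z => exchangeScheme_eq_mixture (M := M) (w := w) (t := t) (φ := φ) hm he hμ y z) x T (exchangeScheme_independent hT) n hs'
  rw [hsum] at h
  convert h

omit [DecidableEq S] in
/-- **`π̃{z : ∃ k ∈ T, z_k = x_k} ≤ Σ_{k∈T} μ_k(x_k)`** (union bound on the product law). [ours] -/
theorem tensorFun_mass_someKept_le [DecidableEq S] (hμ : ∀ k x, 0 < μ k x) (hμ1 : ∀ k, ∑ u, μ k u = 1)
    (x : Fin (K + 1) → S) (T : Finset (Fin (K + 1))) :
    ∑ z ∈ univ.filter (fun z : Fin (K + 1) → S => ∃ k ∈ T, z k = x k), tensorFun μ z ≤ ∑ k ∈ T, μ k (x k) := by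
  have hπ := tensorFun_pos hμ
  calc ∑ z ∈ univ.filter (fun z : Fin (K + 1) → S => ∃ k ∈ T, z k = x k), tensorFun μ z
      = ∑ z, tensorFun μ z * (if ∃ k ∈ T, z k = x k then (1 : ℝ) else 0) := by
        rw [Finset.sum_filter]; exact sum_congr rfl fun z _ => by split_ifs <;> simp
    _ ≤ ∑ z, tensorFun μ z * ∑ k ∈ T, (if z k = x k then (1 : ℝ) else 0) := by
        refine sum_le_sum fun z _ => mul_le_mul_of_nonneg_left ?_ (hπ z).le
        split_ifs with h
        · obtain ⟨k, hk, hzk⟩ := h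
          exact le_trans (by rw [if_pos hzk])
            (Finset.single_le_sum (f := fun k => if z k = x k then (1 : ℝ) else 0)
              (fun k _ => by split_ifs <;> norm_num) hk)
        · exact sum_nonneg fun k _ => by split_ifs <;> norm_num
    _ = ∑ k ∈ T, ∑ z, tensorFun μ z * (if z k = x k then (1 : ℝ) else 0) := by
        simp_rw [mul_sum]; rw [sum_comm]
    _ = ∑ k ∈ T, μ k (x k) := by
        refine sum_congr rfl fun k _ => ?_
        have h := tensorFun_mass_levelSector (μ := μ) hμ1 k {x k}
        rw [Finset.sum_singleton] at h
        rw [← h, Finset.sum_filter]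
        exact sum_congr rfl fun z _ => by simp only [Finset.mem_singleton, mul_ite, mul_one, mul_zero]

/-- **`d(n) ≥ 1 − 1/Σ_{k∈T}(1−θ_k)ⁿ − Σ_{k∈T} μ_k(x_k)`** for the exchange scheme, every start `x`, every set `T` of
levels no entry joins. [ours] -/
theorem exchangeScheme_worstTvDist_ge (hm : 1 ≤ m) (he : ∀ r, (e r).1 ≠ (e r).2) (hμ : ∀ k x, 0 < μ k x)
    (hμ1 : ∀ k, ∑ u, μ k u = 1) (hM : ∀ k, IsRowStochastic (M k)) (hw0 : ∀ k, 0 ≤ w k) (hw1 : ∑ k, w k = 1)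
    (ht0 : 0 ≤ t) (ht1 : t ≤ 1) (x : Fin (K + 1) → S) (T : Finset (Fin (K + 1)))
    (hT : ∀ r, ¬((e r).1 ∈ T ∧ (e r).2 ∈ T)) (n : ℕ)
    (hs : 0 < ∑ k ∈ T, (1 - (t * ((univ.filter fun r : Fin m => (e r).1 = k ∨ (e r).2 = k).card : ℝ) / m
          + (1 - t) * w k)) ^ n) :
    1 - 1 / (∑ k ∈ T, (1 - (t * ((univ.filter fun r : Fin m => (e r).1 = k ∨ (e r).2 = k).card : ℝ) / m
          + (1 - t) * w k)) ^ n) - ∑ k ∈ T, μ k (x k)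
      ≤ worstTvDist (fun y z : Fin (K + 1) → S => t * ptGraphSwap μ e φ y z + (1 - t) * prodKernel w M y z)
          (tensorFun μ) n := by
  have hB := tensorFun_mass_someKept_le hμ hμ1 x T
  have hsum := exchangeScheme_touchSum_eq (e := e) (w := w) (t := t) T n
  have hs' := hs
  rw [← hsum] at hs'
  have h := worstTvDist_ge_collector (exchangeScheme_weights_nonneg (m := m) hw0 ht0 ht1)
    (exchangeScheme_weights_sum (t := t) hm hw1)
    (exchangeScheme_kernels_isRowStochastic (φ := φ) he hμ hM) (exchangeScheme_kernels_local (μ := μ) (M := M) (φ := φ) he)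
    (fun y z => exchangeScheme_eq_mixture (M := M) (w := w) (t := t) (φ := φ) hm he hμ y z) (sum_tensorFun_eq_one μ hμ1) x T
    (exchangeScheme_independent hT) n hs'
  rw [hsum] at h
  -- the two elaborations of the set `{z : ∃ k ∈ T, z_k = x_k}` may carry different decidability instances
  have h' : 1 - 1 / (∑ k ∈ T, (1 - (t * ((univ.filter fun r : Fin m => (e r).1 = k ∨ (e r).2 = k).card : ℝ) / m
          + (1 - t) * w k)) ^ n) - ∑ z ∈ univ.filter (fun z : Fin (K + 1) → S => ∃ k ∈ T, z k = x k), tensorFun μ z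
      ≤ worstTvDist (fun y z : Fin (K + 1) → S => t * ptGraphSwap μ e φ y z + (1 - t) * prodKernel w M y z)
          (tensorFun μ) n := by
    convert h
  linarith

/-- **`n < t_mix(ε)` whenever `ε < 1 − 1/Σ_{k∈T}(1−θ_k)ⁿ − Σ_{k∈T} μ_k(x_k)`** (reversible updates, the scheme `ε`-close
to `π̃` at some time) — the form that accepts any lower bound on the touch sum. [ours] -/
theorem exchangeScheme_lt_mixingTime (hm : 1 ≤ m) (he : ∀ r, (e r).1 ≠ (e r).2) (hμ : ∀ k x, 0 < μ k x)
    (hμ1 : ∀ k, ∑ u, μ k u = 1) (hM : ∀ k, IsRowStochastic (M k)) (hMrev : ∀ k, DetailedBalance (μ k) (M k))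
    (hw0 : ∀ k, 0 ≤ w k) (hw1 : ∑ k, w k = 1) (ht0 : 0 ≤ t) (ht1 : t ≤ 1) (x : Fin (K + 1) → S)
    (T : Finset (Fin (K + 1))) (hT : ∀ r, ¬((e r).1 ∈ T ∧ (e r).2 ∈ T)) (n : ℕ)
    (hs : 0 < ∑ k ∈ T, (1 - (t * ((univ.filter fun r : Fin m => (e r).1 = k ∨ (e r).2 = k).card : ℝ) / m
          + (1 - t) * w k)) ^ n) {ε : ℝ}
    (hε : ε < 1 - 1 / (∑ k ∈ T, (1 - (t * ((univ.filter fun r : Fin m => (e r).1 = k ∨ (e r).2 = k).card : ℝ) / m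
          + (1 - t) * w k)) ^ n) - ∑ k ∈ T, μ k (x k))
    (hmix : ∃ t₀, worstTvDist (fun y z : Fin (K + 1) → S => t * ptGraphSwap μ e φ y z + (1 - t) * prodKernel w M y z)
      (tensorFun μ) t₀ ≤ ε) :
    n < mixingTime (fun y z : Fin (K + 1) → S => t * ptGraphSwap μ e φ y z + (1 - t) * prodKernel w M y z)
      (tensorFun μ) ε := by
  have hP := weightedScheme_isRowStochastic (t := t) (w := w) (ptGraphSwap_isRowStochastic (e := e) (φ := φ) hμ) hM
    hw0 hw1 ht0 ht1
  have hst := (weightedScheme_detailedBalance (w := w) (ptGraphSwap_detailedBalance (e := e) (φ := φ) hμ) hMrev t).isStationary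
    hP.2
  by_contra hn
  push Not at hn
  obtain ⟨t₀, ht₀⟩ := hmix
  have hd := worstTvDist_le_of_mixingTime_le hP hst ht₀ hn
  linarith [exchangeScheme_worstTvDist_ge (φ := φ) hm he hμ hμ1 hM hw0 hw1 ht0 ht1 x T hT n hs]

/-- **THE COUPON-COLLECTOR FLOOR FOR EXCHANGE SCHEMES:** on any swap list with `μ_k`-reversible updates, a non-empty set
`T` of levels no entry joins with `θ_k = t·deg(k)/m + (1−t)·w_k ≤ θ` on `T` (`0 < θ < 1`), a configuration `x` with
`Σ_{k∈T} μ_k(x_k) ≤ δ`, `0 < η`, `ε < 1 − η − δ`, and the scheme `ε`-close to `π̃` at some time: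
**`t_mix(ε) ≥ ((1−θ)/θ)·log(|T|·η)`**. [ours] -/
theorem exchangeScheme_mixingTime_ge (hm : 1 ≤ m) (he : ∀ r, (e r).1 ≠ (e r).2) (hμ : ∀ k x, 0 < μ k x)
    (hμ1 : ∀ k, ∑ u, μ k u = 1) (hM : ∀ k, IsRowStochastic (M k)) (hMrev : ∀ k, DetailedBalance (μ k) (M k))
    (hw0 : ∀ k, 0 ≤ w k) (hw1 : ∑ k, w k = 1) (ht0 : 0 ≤ t) (ht1 : t ≤ 1) (x : Fin (K + 1) → S)
    (T : Finset (Fin (K + 1))) (hT : ∀ r, ¬((e r).1 ∈ T ∧ (e r).2 ∈ T)) (hTne : T.Nonempty)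
    {θ η δ ε : ℝ} (hθ0 : 0 < θ) (hθ1 : θ < 1) (hη : 0 < η)
    (hθ : ∀ k ∈ T, t * ((univ.filter fun r : Fin m => (e r).1 = k ∨ (e r).2 = k).card : ℝ) / m + (1 - t) * w k ≤ θ)
    (hδ : ∑ k ∈ T, μ k (x k) ≤ δ) (hgap : ε < 1 - η - δ)
    (hmix : ∃ t₀, worstTvDist (fun y z : Fin (K + 1) → S => t * ptGraphSwap μ e φ y z + (1 - t) * prodKernel w M y z)
      (tensorFun μ) t₀ ≤ ε) :
    (1 - θ) / θ * Real.log (T.card * η)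
      ≤ (mixingTime (fun y z : Fin (K + 1) → S => t * ptGraphSwap μ e φ y z + (1 - t) * prodKernel w M y z)
          (tensorFun μ) ε : ℝ) := by
  have hP := weightedScheme_isRowStochastic (t := t) (w := w) (ptGraphSwap_isRowStochastic (e := e) (φ := φ) hμ) hM
    hw0 hw1 ht0 ht1
  have hst := (weightedScheme_detailedBalance (w := w) (ptGraphSwap_detailedBalance (e := e) (φ := φ) hμ) hMrev t).isStationary
    hP.2
  have hθ' : ∀ k ∈ T, ∑ a ∈ univ.filter (fun a : Fin m ⊕ Fin (K + 1) =>
        k ∈ Sum.elim (fun r => ({(e r).1, (e r).2} : Finset (Fin (K + 1)))) (fun j => {j}) a),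
      Sum.elim (fun _ : Fin m => t / m) (fun j => (1 - t) * w j) a ≤ θ := fun k hk => by
    rw [exchangeScheme_touchRate (e := e) (w := w) (t := t) k]; exact hθ k hk
  have h := mixingTime_ge_collector (exchangeScheme_weights_nonneg (m := m) hw0 ht0 ht1)
    (exchangeScheme_weights_sum (t := t) hm hw1)
    (exchangeScheme_kernels_isRowStochastic (φ := φ) he hμ hM) (exchangeScheme_kernels_local (μ := μ) (M := M) (φ := φ) he)
    (fun y z => exchangeScheme_eq_mixture (M := M) (w := w) (t := t) (φ := φ) hm he hμ y z) (sum_tensorFun_eq_one μ hμ1) hst x T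
    (exchangeScheme_independent hT) hTne hθ0 hθ1 hη hθ'
    (by convert (tensorFun_mass_someKept_le hμ hμ1 x T).trans hδ using 3; rfl) hgap hmix
  exact h

end Floor

end Summit.Ventures.LatticeQCDFlow.Scaling

end
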